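import Literature.NumberTheory.LFunctions.TypeLimitsExist

/-!
# [CV] Lemma 3.4 (local summability from the 2-point design) and the single finite-type-inequality interface
# of the 2001 design calculus (W-MAG §§3–5, [CV] §§3–4)

The analytic machine of the 2001 magnification programme (archive `2001`: `rh-w-magnification/free/y1` = W-MAG
§§2–3, `rh-w-composite-vanishing/free/y1` = [CV] Prop. 2.4 + App. A; in the tree: the comb evaluation of the crux
line `Summits/RiemannHypothesis/RiemannHypothesis/Cruxes/ConeMagnification/Lines/Sketch.lean`, stubs
`stub_combLocal`/`stub_combType`) delivers, for every finitely supported resonator `α` and a family of smooth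
cut-off weights `w_i` (logarithmic Riesz means `w_M(n) = (1 − log(κ_M n)/log M)₊`), **finite weighted type
inequalities** `∑_n ((c−Λ)(n)/n)·Re Φ_α(n)·w_i(n) ≤ D·Re Φ_α(1) + ε` (eventually in `i`).  Everything AFTER that
is arithmetic, and is PROVED here:

* `summable_of_sum_mul_weight_le` — Fatou for weighted sums: `f ≥ 0` with eventually bounded weighted partial
  sums (weights `→ 1` pointwise) is summable;
* `twoPoint p t` — the 2-point resonator `δ₁ + t·δ_p` ([CV] Lemma 3.4's design) and its gcd form
  `Re Φ(n) = (1 + t² + 2t/√p) + [p ∣ n]·t(√p − 1/√p)` (`re_gcdForm_twoPoint`);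
* `summable_local_of_twoPoint_bound` — **[CV] Lemma 3.4**: for `c ≥ 0` with `∑_{n<N} (c−Λ)(n)/n → C₁`, ONE
  eventual bound `∑_n ((c−Λ)(n)/n) Re Φ(n) w_i(n) ≤ K` for the 2-point design at `p` with some `t > 0` (weights
  eventually nonincreasing, in `[0,1]`, finitely supported, `→ 1` pointwise) forces local summability
  `∑_{p ∣ n} c(n)/n < ∞` (the conclusion of `stub_combLocal`, verbatim);
* `typeLimit_le_of_eventually_le` — the `M → ∞` step packaged: eventual finite bounds `≤ D' + ε` (all `ε > 0`)
  bound the limit of a convergent series by `D'`;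
* `designData_of_mertens_local_finiteTypeIneq`, `designData_of_mertens_finiteTypeIneq` — the design data
  AX-A ∧ AX-B ∧ AX-C(`D`) (conclusion of `stub_designOfTypes`, verbatim) from `c ≥ 0`, `c 1 = 0`, Mertens for `c`
  (conclusion (ii) of `stub_fakeMertens`, verbatim), [local summability,] and the finite weighted type
  inequalities for every finitely supported complex resonator — the single analytic residual.

Sources: archive `2001` — [CV] Lemmas 3.4–3.5, W-MAG §§3–5 (statement level: stockroom
`Rh_WMagnificationY1_MagDeficit.lean`, `Rh_WCompositeVanishingY1_CompositeVanishing.lean` field `summable_comp`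
"B_q < ∞"); unpublished internal preprints; everything here is PROVED (`[folklore]` tags).
-/

noncomputable section

open scoped BigOperators ComplexConjugate Classical
open Filter Finset ArithmeticFunction
open _root_.Topology

namespace Literature.NumberTheory.LFunctions

namespace TypeDesign

open GcdForm

/-! ### Fatou for weighted sums -/

/-- **Fatou for weighted sums.**  If `f ≥ 0`, the weights satisfy `w_i(n) → 1` pointwise along a nontrivial
filter, and for every `K` eventually `∑_{n<K} f(n) w_i(n) ≤ B`, then `f` is summable and `∑ f ≤ B`. [folklore] -/
theorem summable_of_sum_mul_weight_le {f : ℕ → ℝ} (hf : ∀ n, 0 ≤ f n) {ι : Type*} {l : Filter ι} [l.NeBot]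
    (w : ι → ℕ → ℝ) (hw_one : ∀ n, Tendsto (fun i => w i n) l (𝓝 1)) {B : ℝ}
    (hB : ∀ K : ℕ, ∀ᶠ i in l, ∑ n ∈ Finset.range K, f n * w i n ≤ B) :
    Summable f ∧ ∑' n, f n ≤ B := by
  have hK : ∀ K : ℕ, ∑ n ∈ Finset.range K, f n ≤ B := fun K => by
    have ht : Tendsto (fun i => ∑ n ∈ Finset.range K, f n * w i n) l
        (𝓝 (∑ n ∈ Finset.range K, f n * 1)) :=
      tendsto_finsetSum (Finset.range K) fun n _ => (hw_one n).const_mul (f n)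
    simp only [mul_one] at ht
    exact le_of_tendsto ht (hB K)
  exact ⟨summable_of_sum_range_le hf hK, Real.tsum_le_of_sum_range_le hf hK⟩

/-! ### The 2-point resonator `δ₁ + t δ_p` and its gcd form -/

/-- The local vectors of the 2-point resonator: `(1, t)` at every prime. [folklore] -/
def twoPointVec (t : ℝ) : ℕ → ℕ → ℝ := fun _ => vtwo 1 t

/-- The **2-point resonator** `δ₁ + t·δ_p` of [CV] Lemma 3.4, as a product resonator at the single prime `p`,
level `1`. [folklore] -/
def twoPoint (p : ℕ) (t : ℝ) : ℕ → ℂ := prodResonator {p} 1 (fun q i => ((twoPointVec t q i : ℝ) : ℂ))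

/-- `N_{{p}} = p`. [folklore] -/
theorem smoothModulus_singleton_one (p : ℕ) : smoothModulus {p} 1 = p := by
  simp [smoothModulus]

/-- The 2-point resonator vanishes above `p`. [folklore] -/
theorem twoPoint_eq_zero_of_lt (p : ℕ) (t : ℝ) {m : ℕ} (hm : p < m) : twoPoint p t m = 0 := by
  unfold twoPoint
  exact prodResonator_eq_zero_of_lt _ (by rwa [smoothModulus_singleton_one])

/-- **The gcd form of the 2-point resonator** (level `p`, `n ≥ 1`):
`Re Φ(n) = (1 + t² + 2t/√p) + [p ∣ n]·t(√p − 1/√p)`, i.e. `1 + t² + (t/√p)(1 + gcd(n,p))`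
([CV] Lemma 3.3(i) with `(x₀, x₁) = (1, t)`). [folklore] -/
theorem re_gcdForm_twoPoint {p : ℕ} (hp : p.Prime) (t : ℝ) {n : ℕ} (hn : n ≠ 0) :
    (gcdForm (twoPoint p t) p n).re =
      (1 + t ^ 2 + 2 * t * (Real.sqrt p)⁻¹) + (if p ∣ n then t * (Real.sqrt p - (Real.sqrt p)⁻¹) else 0) := by
  unfold twoPoint
  have hP : ∀ q ∈ ({p} : Finset ℕ), q.Prime := fun q hq => by rwa [Finset.mem_singleton.mp hq]
  rw [gcdForm_prodResonator_ofReal hP 1 (twoPointVec t) (by rw [smoothModulus_singleton_one]) hn,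
    Complex.ofReal_re, Finset.prod_singleton]
  unfold twoPointVec
  split_ifs with h
  · rw [locProfile_vtwo_of_dvd hp hn h 1 t]
    ring
  · rw [locProfile_vtwo_of_not_dvd hp h 1 t]
    ring

/-! ### [CV] Lemma 3.4: local summability from one bounded 2-point type sum -/

/-- **[CV] Lemma 3.4 (`B_p < ∞` from the 2-point design).**  Let `c ≥ 0` with `∑_{n<N} (c−Λ)(n)/n → C₁`, let
`w_i` be weights that are eventually nonincreasing, valued in `[0,1]`, vanishing from `N i` on, and tend to `1`
pointwise along a nontrivial filter `l`, and suppose that for the 2-point design at the prime `p` with some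
`t > 0` the weighted type sums are eventually bounded: `∑_{n<N i} ((c−Λ)(n)/n)·Re Φ(n)·w_i(n) ≤ K`.  Then
`∑_{p ∣ n} c(n)/n < ∞` (the conclusion of the crux stub `stub_combLocal`).  Proof: `Re Φ(n) = A + B·[p ∣ n]`
with `A, B > 0`; the plain weighted sums tend to `C₁` (regularity, `tendsto_sum_mul_weight_of_tendsto`), so the
weighted sums over the multiples of `p` are eventually bounded; add back the (summable) `Λ`-part and apply Fatou.
[folklore] -/
theorem summable_local_of_twoPoint_bound {c : ℕ → ℝ} (hc : ∀ n, 0 ≤ c n) {p : ℕ} (hp : p.Prime)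
    {t : ℝ} (ht : 0 < t) {C₁ : ℝ}
    (hC₁ : Tendsto (fun M : ℕ => ∑ n ∈ Finset.range M, (c n - Λ n) / n) atTop (𝓝 C₁))
    {ι : Type*} {l : Filter ι} [l.NeBot] (w : ι → ℕ → ℝ) (N : ι → ℕ)
    (hw_anti : ∀ᶠ i in l, Antitone (w i)) (hw_nonneg : ∀ᶠ i in l, ∀ n, 0 ≤ w i n)
    (hw_le : ∀ᶠ i in l, ∀ n, w i n ≤ 1) (hw_zero : ∀ᶠ i in l, ∀ n, N i ≤ n → w i n = 0)
    (hw_one : ∀ n, Tendsto (fun i => w i n) l (𝓝 1)) {K : ℝ}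
    (hK : ∀ᶠ i in l, ∑ n ∈ Finset.range (N i),
      (c n - Λ n) / n * (gcdForm (twoPoint p t) p n).re * w i n ≤ K) :
    Summable fun n : ℕ => if p ∣ n then c n / n else 0 := by
  -- the two coefficients of the 2-point profile
  set A : ℝ := 1 + t ^ 2 + 2 * t * (Real.sqrt p)⁻¹ with hA
  set B : ℝ := t * (Real.sqrt p - (Real.sqrt p)⁻¹) with hB
  have hp1 : (1 : ℝ) < p := by exact_mod_cast hp.one_lt
  have hsqrt1 : 1 < Real.sqrt p := by
    rw [show (1 : ℝ) = Real.sqrt 1 from Real.sqrt_one.symm]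
    exact Real.sqrt_lt_sqrt zero_le_one hp1
  have hsqrt0 : 0 < Real.sqrt p := one_pos.trans hsqrt1
  have hA0 : 0 < A := by positivity
  have hB0 : 0 < B := by
    have : (Real.sqrt p)⁻¹ < 1 := inv_lt_one_of_one_lt₀ hsqrt1
    have : 0 < Real.sqrt p - (Real.sqrt p)⁻¹ := by linarith
    positivity
  -- decomposition of the weighted 2-point type sum
  have hdec : ∀ (i : ι) (M : ℕ), ∑ n ∈ Finset.range M,
      (c n - Λ n) / n * (gcdForm (twoPoint p t) p n).re * w i n =
        A * ∑ n ∈ Finset.range M, (c n - Λ n) / n * w i n +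
          B * ∑ n ∈ Finset.range M, (if p ∣ n then (c n - Λ n) / n else 0) * w i n := by
    intro i M
    rw [Finset.mul_sum, Finset.mul_sum, ← Finset.sum_add_distrib]
    refine Finset.sum_congr rfl fun n _ => ?_
    rcases eq_or_ne n 0 with rfl | hn
    · simp
    · rw [re_gcdForm_twoPoint hp t hn]
      split_ifs <;> ring
  -- the plain weighted sums tend to `C₁`
  have hplain : Tendsto (fun i => ∑ n ∈ Finset.range (N i), (c n - Λ n) / n * w i n) l (𝓝 C₁) :=
    tendsto_sum_mul_weight_of_tendsto hC₁ w N hw_anti hw_nonneg hw_zero hw_one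
  have hplain' : ∀ᶠ i in l, C₁ - 1 < ∑ n ∈ Finset.range (N i), (c n - Λ n) / n * w i n :=
    hplain.eventually (eventually_gt_nhds (by linarith))
  -- the `Λ`-part on the multiples of `p` is summable
  have hΛ := summable_vonMangoldt_div_of_dvd hp
  have hΛ0 : ∀ n, 0 ≤ (if p ∣ n then (Λ n : ℝ) / n else 0) := fun n => by
    split_ifs
    · exact div_nonneg vonMangoldt_nonneg (Nat.cast_nonneg _)
    · exact le_rfl
  set SΛ : ℝ := ∑' n, (if p ∣ n then (Λ n : ℝ) / n else 0) with hSΛ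
  -- Fatou
  have hf : ∀ n, 0 ≤ (if p ∣ n then c n / n else 0 : ℝ) := fun n => by
    split_ifs
    · exact div_nonneg (hc n) (Nat.cast_nonneg _)
    · exact le_rfl
  refine (summable_of_sum_mul_weight_le hf w hw_one (B := (K - A * (C₁ - 1)) / B + SΛ) fun K₀ => ?_).1
  filter_upwards [hK, hplain', hw_nonneg, hw_le, hw_zero] with i hKi hpi hnn hle hz
  -- (a) the weighted sums over the multiples of `p` are bounded
  have step1 : ∑ n ∈ Finset.range (N i), (if p ∣ n then (c n - Λ n) / n else 0) * w i n ≤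
      (K - A * (C₁ - 1)) / B := by
    rw [hdec i (N i)] at hKi
    rw [le_div_iff₀ hB0]
    nlinarith [mul_lt_mul_of_pos_left hpi hA0]
  -- (b) add back the `Λ`-part
  have step2 : ∑ n ∈ Finset.range (N i), (if p ∣ n then c n / n else 0) * w i n ≤
      (K - A * (C₁ - 1)) / B + SΛ := by
    have hsplit : ∀ n, (if p ∣ n then c n / n else 0 : ℝ) * w i n =
        (if p ∣ n then (c n - Λ n) / n else 0) * w i n + (if p ∣ n then (Λ n : ℝ) / n else 0) * w i n := by
      intro n
      split_ifs <;> ring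
    rw [Finset.sum_congr rfl fun n _ => hsplit n, Finset.sum_add_distrib]
    refine add_le_add step1 ?_
    calc ∑ n ∈ Finset.range (N i), (if p ∣ n then (Λ n : ℝ) / n else 0) * w i n
        ≤ ∑ n ∈ Finset.range (N i), (if p ∣ n then (Λ n : ℝ) / n else 0) :=
          Finset.sum_le_sum fun n _ => by
            calc (if p ∣ n then (Λ n : ℝ) / n else 0) * w i n
                ≤ (if p ∣ n then (Λ n : ℝ) / n else 0) * 1 := mul_le_mul_of_nonneg_left (hle n) (hΛ0 n)
              _ = _ := mul_one _
      _ ≤ SΛ := hΛ.sum_le_tsum _ fun n _ => hΛ0 n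
  -- (c) partial sums below `K₀` are dominated by the full (finitely supported) sum
  calc ∑ n ∈ Finset.range K₀, (if p ∣ n then c n / n else 0) * w i n
      ≤ ∑ n ∈ Finset.range (max K₀ (N i)), (if p ∣ n then c n / n else 0) * w i n :=
        Finset.sum_le_sum_of_subset_of_nonneg (Finset.range_mono (le_max_left _ _))
          fun n _ _ => mul_nonneg (hf n) (hnn n)
    _ = ∑ n ∈ Finset.range (N i), (if p ∣ n then c n / n else 0) * w i n := by
        symm
        refine Finset.sum_subset (Finset.range_mono (le_max_right _ _)) fun n _ hn' => ?_
        have hNn : N i ≤ n := by simpa using hn'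
        rw [hz n hNn, mul_zero]
    _ ≤ (K - A * (C₁ - 1)) / B + SΛ := step2

/-! ### The `M → ∞` step, packaged -/

/-- If `∑_{n<N} a(n) → T` and, for regular weights `w_i` (eventually nonincreasing, nonnegative, vanishing from
`N i` on, `→ 1` pointwise), the weighted sums are eventually `≤ D' + ε` for every `ε > 0`, then `T ≤ D'`.
[folklore] -/
theorem typeLimit_le_of_eventually_le {a : ℕ → ℝ} {T : ℝ}
    (ha : Tendsto (fun M : ℕ => ∑ n ∈ Finset.range M, a n) atTop (𝓝 T))
    {ι : Type*} {l : Filter ι} [l.NeBot] (w : ι → ℕ → ℝ) (N : ι → ℕ)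
    (hw_anti : ∀ᶠ i in l, Antitone (w i)) (hw_nonneg : ∀ᶠ i in l, ∀ n, 0 ≤ w i n)
    (hw_zero : ∀ᶠ i in l, ∀ n, N i ≤ n → w i n = 0)
    (hw_one : ∀ n, Tendsto (fun i => w i n) l (𝓝 1)) {D' : ℝ}
    (hD : ∀ ε : ℝ, 0 < ε → ∀ᶠ i in l, ∑ n ∈ Finset.range (N i), a n * w i n ≤ D' + ε) :
    T ≤ D' := by
  have h := tendsto_sum_mul_weight_of_tendsto ha w N hw_anti hw_nonneg hw_zero hw_one
  exact le_of_forall_pos_le_add fun ε hε => le_of_tendsto h (hD ε hε)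

/-! ### The single analytic residual: finite weighted type inequalities ⟹ design data -/

/-- **Design data from Mertens, local summability and the finite weighted type inequalities** (W-MAG §§3–5,
[CV] §§3–4, arithmetic halves supplied).  For `c ≥ 0`, `c 1 = 0`, Mertens for `c` (conclusion (ii) of
`stub_fakeMertens`, verbatim), local summability (conclusion of `stub_combLocal`, verbatim), a regular family of
cut-off weights `w_i` (eventually nonincreasing, nonnegative, vanishing from `N i` on; `→ 1` pointwise; e.g.
the logarithmic Riesz weights, `tendsto_sum_mul_logRiesz_of_tendsto`), and the FINITE weighted type inequalities
`∑_{n<N i} ((c−Λ)(n)/n)·Re Φ_α(n)·w_i(n) ≤ D·Re Φ_α(1) + ε` (eventually in `i`, every `ε > 0`, every finitely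
supported complex `α`): the design data AX-A ∧ AX-B ∧ AX-C(`D`) of `stub_designOfTypes` (verbatim; `D = 1/2`
there). [folklore] -/
theorem designData_of_mertens_local_finiteTypeIneq (D : ℝ) (c : ℕ → ℝ) (hc : ∀ n, 0 ≤ c n) (hc1 : c 1 = 0)
    (hM : ∃ C : ℝ, Filter.Tendsto (fun x : ℝ => (∑ n ∈ Finset.Icc 1 ⌊x⌋₊, c n / n) - Real.log x)
      Filter.atTop (nhds C))
    (hloc : ∀ p : ℕ, p.Prime → Summable (fun n : ℕ => if p ∣ n then c n / n else 0))
    {ι : Type*} {l : Filter ι} [l.NeBot] (w : ι → ℕ → ℝ) (N : ι → ℕ)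
    (hw_anti : ∀ᶠ i in l, Antitone (w i)) (hw_nonneg : ∀ᶠ i in l, ∀ n, 0 ≤ w i n)
    (hw_zero : ∀ᶠ i in l, ∀ n, N i ≤ n → w i n = 0)
    (hw_one : ∀ n, Tendsto (fun i => w i n) l (𝓝 1))
    (hfin : ∀ α : ℕ → ℂ, ∀ L : ℕ, (∀ m, L < m → α m = 0) → ∀ ε : ℝ, 0 < ε →
      ∀ᶠ i in l, ∑ n ∈ Finset.range (N i),
        (c n - ArithmeticFunction.vonMangoldt n) / n * (gcdForm α L n).re * w i n ≤
          D * (gcdForm α L 1).re + ε) :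
    Summable (fun n : ℕ => |c n - ArithmeticFunction.vonMangoldt n| / (n : ℝ)) ∧
    Summable (fun n : ℕ => if 2 ≤ n ∧ ¬ IsPrimePow n then
      c n / (n : ℝ) * (∑ q ∈ n.primeFactors, ∑ q' ∈ n.primeFactors.filter (fun q' => q < q'),
        ((Real.sqrt q - 1) / 2) * ((Real.sqrt q' - 1) / 2)) else 0) ∧
    (∀ S : Finset ℕ, (∀ p ∈ S, p.Prime) → ∀ a : ℕ → ℝ, (∀ p ∈ S, 0 ≤ a p ∧ a p ≤ 1) → ∀ φ : ℝ,
      (∑' n : ℕ, (c n - ArithmeticFunction.vonMangoldt n) / (n : ℝ) *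
        (if ∀ p ∈ S, ¬ (p ^ 2 ∣ n) then
          Real.sqrt (∏ p ∈ S.filter (· ∣ n), (p : ℝ)) * (∏ p ∈ S.filter (· ∣ n), a p) *
            (1 / 2) ^ (S.filter (· ∣ n)).card * Real.cos (((S.filter (· ∣ n)).card : ℝ) * φ)
        else 0)) ≤ D) := by
  refine designData_of_mertens_typeBound D c hc hc1 hM hloc fun α L hα T hT => ?_
  have hT' : Tendsto (fun M : ℕ => ∑ n ∈ Finset.range M,
      (c n - ArithmeticFunction.vonMangoldt n) / n * (gcdForm α L n).re) atTop (𝓝 T) :=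
    tendsto_sum_range_of_tendsto_sum_Icc_floor
      (f := fun n => (c n - ArithmeticFunction.vonMangoldt n) / n * (gcdForm α L n).re) (by simp) hT
  exact typeLimit_le_of_eventually_le hT' w N hw_anti hw_nonneg hw_zero hw_one (hfin α L hα)

/-- **Design data from Mertens and the finite weighted type inequalities alone** — the single analytic
residual of the 2001 magnification step: as `designData_of_mertens_local_finiteTypeIneq`, with local summability
DERIVED ([CV] Lemma 3.4, `summable_local_of_twoPoint_bound`) from the finite inequality for the 2-point design
`δ₁ + δ_p` (`t = 1`, `ε = 1`); here the weights are also asked to be eventually `≤ 1`. [folklore] -/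
theorem designData_of_mertens_finiteTypeIneq (D : ℝ) (c : ℕ → ℝ) (hc : ∀ n, 0 ≤ c n) (hc1 : c 1 = 0)
    (hM : ∃ C : ℝ, Filter.Tendsto (fun x : ℝ => (∑ n ∈ Finset.Icc 1 ⌊x⌋₊, c n / n) - Real.log x)
      Filter.atTop (nhds C))
    {ι : Type*} {l : Filter ι} [l.NeBot] (w : ι → ℕ → ℝ) (N : ι → ℕ)
    (hw_anti : ∀ᶠ i in l, Antitone (w i)) (hw_nonneg : ∀ᶠ i in l, ∀ n, 0 ≤ w i n)
    (hw_le : ∀ᶠ i in l, ∀ n, w i n ≤ 1) (hw_zero : ∀ᶠ i in l, ∀ n, N i ≤ n → w i n = 0)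
    (hw_one : ∀ n, Tendsto (fun i => w i n) l (𝓝 1))
    (hfin : ∀ α : ℕ → ℂ, ∀ L : ℕ, (∀ m, L < m → α m = 0) → ∀ ε : ℝ, 0 < ε →
      ∀ᶠ i in l, ∑ n ∈ Finset.range (N i),
        (c n - ArithmeticFunction.vonMangoldt n) / n * (gcdForm α L n).re * w i n ≤
          D * (gcdForm α L 1).re + ε) :
    Summable (fun n : ℕ => |c n - ArithmeticFunction.vonMangoldt n| / (n : ℝ)) ∧
    Summable (fun n : ℕ => if 2 ≤ n ∧ ¬ IsPrimePow n then
      c n / (n : ℝ) * (∑ q ∈ n.primeFactors, ∑ q' ∈ n.primeFactors.filter (fun q' => q < q'),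
        ((Real.sqrt q - 1) / 2) * ((Real.sqrt q' - 1) / 2)) else 0) ∧
    (∀ S : Finset ℕ, (∀ p ∈ S, p.Prime) → ∀ a : ℕ → ℝ, (∀ p ∈ S, 0 ≤ a p ∧ a p ≤ 1) → ∀ φ : ℝ,
      (∑' n : ℕ, (c n - ArithmeticFunction.vonMangoldt n) / (n : ℝ) *
        (if ∀ p ∈ S, ¬ (p ^ 2 ∣ n) then
          Real.sqrt (∏ p ∈ S.filter (· ∣ n), (p : ℝ)) * (∏ p ∈ S.filter (· ∣ n), a p) *
            (1 / 2) ^ (S.filter (· ∣ n)).card * Real.cos (((S.filter (· ∣ n)).card : ℝ) * φ)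
        else 0)) ≤ D) := by
  obtain ⟨C, hC⟩ := hM
  -- `∑_{n<N} (c−Λ)(n)/n → C + γ`
  have hC₁ : Tendsto (fun M : ℕ => ∑ n ∈ Finset.range M,
      (c n - ArithmeticFunction.vonMangoldt n) / n) atTop (𝓝 (C + Real.eulerMascheroniConstant)) :=
    tendsto_sum_range_of_tendsto_sum_Icc_floor
      (f := fun n => (c n - ArithmeticFunction.vonMangoldt n) / n) (by simp)
      (tendsto_sum_sub_vonMangoldt_div_of_mertens hC)
  -- local summability from the 2-point designs `δ₁ + δ_p`
  have hloc : ∀ p : ℕ, p.Prime → Summable (fun n : ℕ => if p ∣ n then c n / n else 0) := fun p hp =>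
    summable_local_of_twoPoint_bound hc hp one_pos hC₁ w N hw_anti hw_nonneg hw_le hw_zero hw_one
      (K := D * (gcdForm (twoPoint p 1) p 1).re + 1)
      (hfin (twoPoint p 1) p (fun m hm => twoPoint_eq_zero_of_lt p 1 hm) 1 one_pos)
  exact designData_of_mertens_local_finiteTypeIneq D c hc hc1 ⟨C, hC⟩ hloc w N hw_anti hw_nonneg hw_zero
    hw_one hfin

end TypeDesign

end Literature.NumberTheory.LFunctions
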